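import Summits.PneNP.PneNP.Theorems.ConvexRankGatesConvexGateBlindExactLiftingMinimalInstance

/-!
# The minimal explicit instance of the strict-rank jump, II: covering the ones, `rk₊(M_t − J) ≥ t³/2`

Support file for crux `ConvexGateBlind` (stmt-PneNP-10680), line `xor-door-perfect-completeness`, open stub
`stub_exactLifting`; continuation of `…ExactLiftingMinimalInstance.lean` (the instance `triLift t = M_t`,
`M_t[x,w] = 1 + 2·[w monochromatic under x]`, its junta factorisation `rk₊(M_t) ≤ 3t²`, and the rectangle lemma
`two_mul_card_rect_le`: every 1-rectangle of `E_t = [monochromatic]` has `2|S||W| ≤ N`). Memo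
`STRICTRANK-MINIMAL-seat3.md` on the item.

* `card_le_four_mul_card_mono` — at least a quarter of all rows make a fixed triangle monochromatic (`N ≤ 4·#mono`).
* `cube_le_two_mul_of_nmf_mono` — **the ε = 1 endpoint**: every non-negative factorisation of the 0/1 matrix `E_t`
  through `ℝ^r_{≥0}` has `t³ ≤ 2r` (rectangle covering: supports of the terms are 1-rectangles covering the
  `≥ t³N/4` ones, each of size `≤ N/2`). There are `t³` columns, so `rk₊(E_t) = Θ(t³)` while `rank E_t ≤ 3t² − 3t + 2`.
* `cube_le_two_mul_of_hasConeFact_shift_one` — the same for `HasConeFact (triLift t − 1) 0 r`.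
* `minimal_instance_endpoints` (registered sub-goal) — both endpoints together.

So for this family `ε ↦ rk₊(M_t − εJ)` climbs (within +1 of monotonically, Hrubeš) from `Θ(t²)` at `ε = 0` to `Θ(t³)`
at `ε = 1`; the strict rank `rk₊₊(M_t) ∈ [3t² − 3t + 1, t³ + 1]` — where the jump happens — is the open technique
question (three equivalent forms in the memo: positive dictionary / linear-size monotone LP for
transversal-triangle-vs-bipartite / relaxations of the triangle marginal polytope). PSD-strict factorisations of size
`O(t²)` exist for every `ε` (degree-2 SOS), so only the LP cone can jump here.
-/

set_option linter.dupNamespace false -- `Summit.PneNP.PneNP.…`: summit = sub-problem (D-0017)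

namespace Summit.PneNP.PneNP.Theorems.XorDoor.Minimal

open scoped BigOperators Classical
open Finset

noncomputable section

variable {t : ℕ}

/-! ## §3 The ε = 1 endpoint: counting the ones and covering them -/

/-- At least a quarter of all rows make a fixed triangle monochromatic: `N ≤ 4 · #{x | Mono x w}`
(overwrite the bits `(1, w 1)`, `(2, w 2)` by `x 0 (w 0)`; fibres have size ≤ 4). -/
theorem card_le_four_mul_card_mono (w : Col t) :
    Fintype.card (Row t) ≤ 4 * (Finset.univ.filter fun x : Row t => Mono x w).card := by
  -- the overwrite map
  let ψ : Row t → Row t := fun x a v =>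
    if (a = 1 ∧ v = w 1) ∨ (a = 2 ∧ v = w 2) then x 0 (w 0) else x a v
  have hψ : ∀ x, Mono (ψ x) w := by
    intro x
    have e0 : ψ x 0 (w 0) = x 0 (w 0) := by simp [ψ]
    have e1 : ψ x 1 (w 1) = x 0 (w 0) := by simp [ψ]
    have e2 : ψ x 2 (w 2) = x 0 (w 0) := by simp [ψ]
    exact ⟨by rw [e0, e1], by rw [e1, e2]⟩
  -- image lands in the monochromatic rows
  have himg : (Finset.univ : Finset (Row t)).image ψ ⊆ Finset.univ.filter fun x : Row t => Mono x w := by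
    intro z hz
    obtain ⟨x, _, rfl⟩ := Finset.mem_image.1 hz
    exact Finset.mem_filter.2 ⟨Finset.mem_univ _, hψ x⟩
  -- fibres have at most 4 elements: x is determined by ψ x and the two overwritten bits
  have hfib : ∀ z ∈ (Finset.univ : Finset (Row t)).image ψ,
      (Finset.univ.filter fun x : Row t => ψ x = z).card ≤ 4 := by
    intro z _
    let cand : Bool × Bool → Row t := fun bc a v =>
      if a = 1 ∧ v = w 1 then bc.1 else if a = 2 ∧ v = w 2 then bc.2 else z a v
    have hsub : (Finset.univ.filter fun x : Row t => ψ x = z) ⊆ (Finset.univ : Finset (Bool × Bool)).image cand := by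
      intro x hx
      have hxz : ψ x = z := (Finset.mem_filter.1 hx).2
      refine Finset.mem_image.2 ⟨(x 1 (w 1), x 2 (w 2)), Finset.mem_univ _, ?_⟩
      funext a v
      by_cases h1 : a = 1 ∧ v = w 1
      · obtain ⟨rfl, rfl⟩ := h1
        simp [cand]
      · by_cases h2 : a = 2 ∧ v = w 2
        · obtain ⟨rfl, rfl⟩ := h2
          simp [cand]
        · have hz' : z a v = x a v := by
            rw [← hxz]
            simp [ψ, h1, h2]
          simp [cand, h1, h2, hz']
    calc (Finset.univ.filter fun x : Row t => ψ x = z).card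
        ≤ ((Finset.univ : Finset (Bool × Bool)).image cand).card := Finset.card_le_card hsub
      _ ≤ (Finset.univ : Finset (Bool × Bool)).card := Finset.card_image_le
      _ = 4 := by simp
  have h := Finset.card_le_mul_card_image (Finset.univ : Finset (Row t)) 4 hfib
  rw [Finset.card_univ] at h
  exact h.trans (Nat.mul_le_mul_left 4 (Finset.card_le_card himg))

/-- **The ε = 1 endpoint: `rk₊(E_t) ≥ t³/2`.** Every non-negative factorisation of the 0/1 matrix
`E_t[x,w] = [w monochromatic under x]` through `ℝ^r_{≥0}` has `t³ ≤ 2r` (rectangle covering with the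
two-coordinate flip bound). -/
theorem cube_le_two_mul_of_nmf_mono {r : ℕ} (U : Row t → Fin r → ℝ) (V : Fin r → Col t → ℝ)
    (hU : ∀ x l, 0 ≤ U x l) (hV : ∀ l w, 0 ≤ V l w)
    (hE : ∀ x w, (if Mono x w then (1 : ℝ) else 0) = ∑ l, U x l * V l w) :
    t ^ 3 ≤ 2 * r := by
  -- supports of the terms
  let S : Fin r → Finset (Row t) := fun l => Finset.univ.filter fun x => 0 < U x l
  let Wl : Fin r → Finset (Col t) := fun l => Finset.univ.filter fun w => 0 < V l w
  -- (a) each support rectangle is a 1-rectangle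
  have hrect : ∀ l, ∀ x ∈ S l, ∀ w ∈ Wl l, Mono x w := by
    intro l x hx w hw
    have hx' : 0 < U x l := (Finset.mem_filter.1 hx).2
    have hw' : 0 < V l w := (Finset.mem_filter.1 hw).2
    have hpos : 0 < ∑ l', U x l' * V l' w :=
      lt_of_lt_of_le (mul_pos hx' hw')
        (Finset.single_le_sum (f := fun l' => U x l' * V l' w)
          (fun l' _ => mul_nonneg (hU x l') (hV l' w)) (Finset.mem_univ l))
    rw [← hE x w] at hpos
    by_contra hm
    simp [hm] at hpos
  -- (b) every one is covered
  have hcov : ∀ x w, Mono x w → ∃ l, x ∈ S l ∧ w ∈ Wl l := by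
    intro x w hm
    by_contra hno
    push Not at hno
    have hzero : ∑ l, U x l * V l w = 0 := by
      apply Finset.sum_eq_zero
      intro l _
      by_cases hx : 0 < U x l
      · have hw : ¬ 0 < V l w := fun hw =>
          hno l (Finset.mem_filter.2 ⟨Finset.mem_univ _, hx⟩) (Finset.mem_filter.2 ⟨Finset.mem_univ _, hw⟩)
        have : V l w = 0 := le_antisymm (not_lt.1 hw) (hV l w)
        simp [this]
      · have : U x l = 0 := le_antisymm (not_lt.1 hx) (hU x l)
        simp [this]
    have h1 := hE x w
    rw [hzero, if_pos hm] at h1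
    exact one_ne_zero h1
  -- (c) count: for each w, #mono rows ≤ Σ_l |S l| · [w ∈ Wl l]
  have hcount : ∀ w, (Finset.univ.filter fun x : Row t => Mono x w).card ≤
      ∑ l, (S l).card * (if w ∈ Wl l then 1 else 0) := by
    intro w
    have hsub : (Finset.univ.filter fun x : Row t => Mono x w) ⊆
        (Finset.univ : Finset (Fin r)).biUnion fun l => if w ∈ Wl l then S l else ∅ := by
      intro x hx
      obtain ⟨l, hxl, hwl⟩ := hcov x w (Finset.mem_filter.1 hx).2
      exact Finset.mem_biUnion.2 ⟨l, Finset.mem_univ _, by simp [hwl, hxl]⟩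
    calc (Finset.univ.filter fun x : Row t => Mono x w).card
        ≤ ((Finset.univ : Finset (Fin r)).biUnion fun l => if w ∈ Wl l then S l else ∅).card :=
          Finset.card_le_card hsub
      _ ≤ ∑ l, (if w ∈ Wl l then S l else ∅ : Finset (Row t)).card := Finset.card_biUnion_le
      _ = ∑ l, (S l).card * (if w ∈ Wl l then 1 else 0) := by
          refine Finset.sum_congr rfl (fun l _ => ?_)
          split_ifs <;> simp
  -- (d) sum over w and swap: Σ_w #mono ≤ Σ_l |S l| · |Wl l|
  have hswap : ∑ w : Col t, ∑ l, (S l).card * (if w ∈ Wl l then 1 else 0) = ∑ l, (S l).card * (Wl l).card := by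
    rw [Finset.sum_comm]
    refine Finset.sum_congr rfl (fun l _ => ?_)
    rw [← Finset.mul_sum]
    congr 1
    rw [Finset.sum_boole]
    simp
  -- (e) assemble: N · t³ ≤ 4 Σ_w #mono ≤ 4 Σ_l |S||W| ≤ 2 r N
  have hN : 0 < Fintype.card (Row t) := Fintype.card_pos
  have hcols : Fintype.card (Col t) = t ^ 3 := by simp [Fintype.card_fin]
  have step1 : Fintype.card (Row t) * t ^ 3 ≤ 4 * ∑ w : Col t, (Finset.univ.filter fun x : Row t => Mono x w).card := by
    calc Fintype.card (Row t) * t ^ 3 = ∑ _w : Col t, Fintype.card (Row t) := by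
            rw [Finset.sum_const, Finset.card_univ, hcols, smul_eq_mul, mul_comm]
      _ ≤ ∑ w : Col t, 4 * (Finset.univ.filter fun x : Row t => Mono x w).card :=
            Finset.sum_le_sum (fun w _ => card_le_four_mul_card_mono w)
      _ = 4 * ∑ w : Col t, (Finset.univ.filter fun x : Row t => Mono x w).card := by rw [Finset.mul_sum]
  have step2 : ∑ w : Col t, (Finset.univ.filter fun x : Row t => Mono x w).card ≤ ∑ l, (S l).card * (Wl l).card := by
    rw [← hswap]
    exact Finset.sum_le_sum (fun w _ => hcount w)
  have step3 : ∑ l, (S l).card * (Wl l).card ≤ ∑ _l : Fin r, Fintype.card (Row t) / 2 := by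
    refine Finset.sum_le_sum (fun l _ => ?_)
    have h2 := two_mul_card_rect_le (S l) (Wl l) (hrect l)
    exact (Nat.le_div_iff_mul_le (by norm_num)).2 (by linarith [h2])
  have step4 : ∑ _l : Fin r, Fintype.card (Row t) / 2 = r * (Fintype.card (Row t) / 2) := by
    rw [Finset.sum_const, Finset.card_univ, Fintype.card_fin, smul_eq_mul]
  have hfin : Fintype.card (Row t) * t ^ 3 ≤ 4 * (r * (Fintype.card (Row t) / 2)) := by
    calc Fintype.card (Row t) * t ^ 3 ≤ 4 * ∑ w : Col t, (Finset.univ.filter fun x : Row t => Mono x w).card := step1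
      _ ≤ 4 * ∑ l, (S l).card * (Wl l).card := Nat.mul_le_mul_left 4 step2
      _ ≤ 4 * (r * (Fintype.card (Row t) / 2)) := by rw [← step4]; exact Nat.mul_le_mul_left 4 step3
  -- 4 · (N / 2) ≤ 2 N
  have hdiv : 4 * (r * (Fintype.card (Row t) / 2)) ≤ (2 * r) * Fintype.card (Row t) := by
    have h2 : 2 * (Fintype.card (Row t) / 2) ≤ Fintype.card (Row t) := Nat.mul_div_le _ 2
    calc 4 * (r * (Fintype.card (Row t) / 2)) = 2 * r * (2 * (Fintype.card (Row t) / 2)) := by ring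
      _ ≤ 2 * r * Fintype.card (Row t) := Nat.mul_le_mul_left _ h2
  have : Fintype.card (Row t) * t ^ 3 ≤ Fintype.card (Row t) * (2 * r) := by
    calc Fintype.card (Row t) * t ^ 3 ≤ (2 * r) * Fintype.card (Row t) := hfin.trans hdiv
      _ = Fintype.card (Row t) * (2 * r) := by ring
  exact Nat.le_of_mul_le_mul_left this hN

/-- **The ε = 1 endpoint in the line's currency.** Every cone factorisation of the shifted matrix
`M_t − J = 2E_t` through `ℝ^r_{≥0}` (no PSD part) has `t³ ≤ 2r`; together with `hasConeFact_triLift`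
(`rk₊(M_t) ≤ 3t²`) this certifies that `ε ↦ rk₊(M_t − εJ)` goes from `Θ(t²)` at `ε = 0` to `Θ(t³)` at `ε = 1`. -/
theorem cube_le_two_mul_of_hasConeFact_shift_one {r : ℕ}
    (h : HasConeFact (fun (x : Row t) (w : Col t) => triLift t x w - 1) 0 r) : t ^ 3 ≤ 2 * r := by
  obtain ⟨H, Y, U, V, _, _, hU, hV, hM⟩ := h
  refine cube_le_two_mul_of_nmf_mono (fun x l => U x l / 2) V (fun x l => by
    have := hU x l; positivity) hV (fun x w => ?_)
  have hm : triLift t x w - 1 = (H x * Y w).trace + ∑ l, U x l * V l w := hM x w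
  have htr : (H x * Y w).trace = 0 := by simp [Matrix.trace]
  rw [htr, zero_add, triLift_eq] at hm
  have hsum : ∑ l, U x l / 2 * V l w = (∑ l, U x l * V l w) / 2 := by
    rw [Finset.sum_div]
    refine Finset.sum_congr rfl (fun l _ => ?_)
    ring
  rw [hsum, ← hm]
  split_ifs <;> norm_num

/-- **Registered sub-goal `minimal_instance_endpoints` (stmt-PneNP-10680): both plain endpoints of the minimal
instance.** `rk₊(M_t) ≤ 3t²` (an explicit `ℝ^{3t²}_{≥0}` cone factorisation of `triLift t`) and `rk₊(M_t − J) ≥ t³/2`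
(every `ℝ^r_{≥0}` cone factorisation of `triLift t − 1` has `t³ ≤ 2r`). The strict rank of `M_t` lies in between and is
the open technique question. -/
theorem minimal_instance_endpoints : (∀ t : ℕ, HasConeFact (triLift t) 0 (3 * (t * t))) ∧ ∀ (t r : ℕ), HasConeFact (fun (x : Fin 3 → Fin t → Bool) (w : Fin 3 → Fin t) => triLift t x w - 1) 0 r → t ^ 3 ≤ 2 * r :=
  ⟨hasConeFact_triLift, fun _ _ h => cube_le_two_mul_of_hasConeFact_shift_one h⟩

end

end Summit.PneNP.PneNP.Theorems.XorDoor.Minimal
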